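import Summits.KontsevichZagierPeriods.KontsevichZagierPeriods.Theorems.IsogenyCertificatesBiellipticRealPeriodCellStubAssembly
import Summits.KontsevichZagierPeriods.KontsevichZagierPeriods.Theorems.IsogenyCertificatesBiellipticRealPeriodCellStubHalfMoves
import Summits.KontsevichZagierPeriods.KontsevichZagierPeriods.Theorems.IsogenyCertificatesXMapKernelCellsUnconditional
import Literature.NumberTheory.Transcendental.PeriodConjecture

/-!
# STRATEGY-CENSUS anchors — crux `BiellipticRealPeriodCell` (stmt-KontsevichZagierPeriods-18685)

Scratch check file of the crux-strategist seat `cstrat-stmt-KontsevichZagierPeriods-18685-s1`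
(2026-08-17). It kernel-checks the claims of `STRATEGY-CENSUS.md` against LANDED tree theorems only
(nothing here is proposed; the one open stub of the live line is the lead's):

* `crux_of_subs` — the Decomposition heading's typed split `CellOneKernel → GeneratorwiseTransfer →
  BiellipticRealPeriodCell`, glue PROVED (transfer principle, re-derived here; the tree's
  `BiellipticRealPeriodCellNegative.inf_le_of_subset_sup` is the same argument in subgroup form);
* `cellOneKernel_holds` — piece 1 is a theorem of the tree (cell (i), p119755);
* `halfMovesSa_holds` — the antecedent of the live line's one open stub
  `stub_assembly_of_halfMovesSa` is the LANDED `stub_halfMoves` (p144820), so the remaining work is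
  exactly `HalfMovesSa → GeneratorwiseTransfer`, and `crux_of_saAssembly` closes the crux from it;
* `withoutBounded_sandwich` — the Strengthen heading's S⁺⁺ (IsBounded dropped) is sandwiched
  between the crux and Conjecture 1 (method-bearing only); `crux_of_genusTwo` — the genus-two cell
  gives the crux (closure monotonicity);
* Negation heading: the disprover's load-bearing theorems (`false_without_additivity`,
  `false_without_cov_nl`, `false_without_changeOfVariables_of_transcendental`, Negative lane, all
  accepted) are cited by name in the census; they are not imported here only because the farm
  snapshot had `Negative.Core` unbuilt at check time.
-/

noncomputable section

set_option linter.dupNamespace false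

namespace Summit.KontsevichZagierPeriods.KontsevichZagierPeriods.Cruxes.BiellipticRealPeriodCell.StrategyCensus

open Literature.NumberTheory.Transcendental
open Literature.ModelTheory.ExponentialFields (IsSemialgebraic)
open Summit.KontsevichZagierPeriods.KontsevichZagierPeriods.Theses.IsogenyCertificates
open Summit.KontsevichZagierPeriods.IsogenyCertificates
open Set MeasureTheory Polynomial

/-- The bielliptic generators (verbatim from the crux). -/
def biellGens : Set KZ.FormalRep :=
  {d : KZ.FormalRep | ∃ (G : Polynomial ℚ) (q a₀ a₁ : ℚ) (r : KZ.IntegralRep 1), G.natDegree = 3 ∧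
    Squarefree (G.comp (Polynomial.X ^ 2)) ∧
    0 < Polynomial.aeval (q : ℝ) (G.comp (Polynomial.X ^ 2)) ∧
    Bornology.IsBounded (connectedComponentIn {y : ℝ | 0 < Polynomial.aeval y (G.comp (Polynomial.X ^ 2))} (q : ℝ)) ∧
    r.domain = {x | x 0 ∈ connectedComponentIn {y : ℝ | 0 < Polynomial.aeval y (G.comp (Polynomial.X ^ 2))} (q : ℝ)} ∧
    Set.EqOn r.integrand (fun x => ((a₀ : ℝ) + (a₁ : ℝ) * x 0) /
      Real.sqrt (Polynomial.aeval (x 0) (G.comp (Polynomial.X ^ 2)))) r.domain ∧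
    d = KZ.of r}

/-- The cell-(i) generators (verbatim from `EllipticPeriodCells`, first conjunct). -/
def cellOneGens : Set KZ.FormalRep :=
  {d : KZ.FormalRep | ∃ (A B : ℤ) (a : ℚ) (r : KZ.IntegralRep 1),
    4 * A ^ 3 + 27 * B ^ 2 ≠ 0 ∧ r.domain = {x | 0 < x 0 ^ 3 + (A : ℝ) * x 0 + (B : ℝ)} ∧
    Set.EqOn r.integrand (fun x => (a : ℝ) / Real.sqrt (x 0 ^ 3 + (A : ℝ) * x 0 + (B : ℝ))) r.domain ∧
    d = KZ.of r}

/-- **Sub₁** (Decomposition heading): the kernel statement of the real-period cell (i). -/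
def CellOneKernel : Prop :=
  ∀ c ∈ AddSubgroup.closure cellOneGens, KZ.eval c = 0 → c ∈ KZ.relations

/-- Sub₁ is a THEOREM of the tree (p119755). -/
theorem cellOneKernel_holds : CellOneKernel := XMapKernelCells.realPeriodCellKernel_relations

/-- **Sub₂** (Decomposition heading) = C⁺ of both idea cards = the conclusion of the live line's
assembly stub: every bielliptic generator is congruent mod `KZ.relations` to an element of the
subgroup generated by the cell-(i) generators. -/
def GeneratorwiseTransfer : Prop :=
  ∀ d ∈ biellGens, ∃ e ∈ AddSubgroup.closure cellOneGens, d - e ∈ KZ.relations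

/-- **Glue of the split, proved**: `Sub₁ → Sub₂ → crux` (transfer principle). -/
theorem crux_of_subs : CellOneKernel → GeneratorwiseTransfer → BiellipticRealPeriodCell := by
  intro h1 h2 c hc h0
  -- transfer principle, self-contained (the tree's `BiellipticRealPeriodCellNegative.inf_le_of_subset_sup`
  -- lives in a module the farm snapshot has not built; re-derived here in 12 lines)
  have hsub : c ∈ AddSubgroup.closure cellOneGens ⊔ KZ.relations := by
    refine (AddSubgroup.closure_le (K := AddSubgroup.closure cellOneGens ⊔ KZ.relations)).2 ?_ hc
    intro d hd
    obtain ⟨e, he, hrel⟩ := h2 d hd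
    have : d = e + (d - e) := by abel
    rw [this]
    exact AddSubgroup.add_mem_sup he hrel
  obtain ⟨b, hb, ρ, hρ, rfl⟩ := AddSubgroup.mem_sup.1 hsub
  have hρ0 : KZ.eval ρ = 0 := AddMonoidHom.mem_ker.1 (KZ.relations_le_ker_eval_holds hρ)
  have hb0 : KZ.eval b = 0 := by
    rw [map_add, hρ0, add_zero] at h0
    exact h0
  exact KZ.relations.add_mem (h1 b hb hb0) hρ

/-- The Sa form of the two half-moves (stub F of the live line, WITH the semialgebraicity
hypothesis on the half-interval) — verbatim the registered `stub_halfMoves`. -/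
def HalfMovesSa : Prop :=
  (∀ (G : ℚ[X]) (m s k : ℚ) (A B : ℤ) (a₁ σ : ℚ) (α β : ℝ), m ≠ 0 → k ≠ 0 →
      (∀ y : ℝ, (m : ℝ) ^ 3 * aeval y (G.comp (X ^ 2)) =
        (k : ℝ) ^ 2 * ((y ^ 2 - s) ^ 3 + (A : ℝ) * m ^ 2 * (y ^ 2 - s) + (B : ℝ) * m ^ 3)) →
      α < β → IsSemialgebraic ℚ {x : Fin 1 → ℝ | x 0 ∈ Ioo α β} →
      ((0 ≤ α ∧ σ = 1) ∨ (β ≤ 0 ∧ σ = -1)) →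
      (∀ y ∈ Ioo α β, 0 < aeval y (G.comp (X ^ 2))) →
      IntegrableOn (fun x : Fin 1 → ℝ => 1 / Real.sqrt (aeval (x 0) (G.comp (X ^ 2)))) {x | x 0 ∈ Ioo α β} →
      ∃ O t : KZ.IntegralRep 1, O.domain = {x | x 0 ∈ Ioo α β} ∧
        O.integrand = (fun x => (a₁ : ℝ) * x 0 / Real.sqrt (aeval (x 0) (G.comp (X ^ 2)))) ∧
        t.domain = {x | x 0 ∈ (fun y : ℝ => (y ^ 2 - s) / m) '' Ioo α β} ∧
        EqOn t.integrand (fun x => ((σ * a₁ * |m| / (2 * |k|) : ℚ) : ℝ) /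
          Real.sqrt (x 0 ^ 3 + (A : ℝ) * x 0 + (B : ℝ))) t.domain ∧
        KZ.of O - KZ.of t ∈ KZ.relations) ∧
  (∀ (G : ℚ[X]) (m s k : ℚ) (A B : ℤ) (a₀ : ℚ) (α β : ℝ), m ≠ 0 → k ≠ 0 →
      (∀ y : ℝ, (m : ℝ) ^ 3 * aeval y (G.comp (X ^ 2)) =
        (k : ℝ) ^ 2 * ((1 - s * y ^ 2) ^ 3 + (A : ℝ) * m ^ 2 * y ^ 4 * (1 - s * y ^ 2) +
          (B : ℝ) * m ^ 3 * y ^ 6)) →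
      α < β → IsSemialgebraic ℚ {x : Fin 1 → ℝ | x 0 ∈ Ioo α β} → (0 ≤ α ∨ β ≤ 0) →
      (∀ y ∈ Ioo α β, 0 < aeval y (G.comp (X ^ 2))) →
      IntegrableOn (fun x : Fin 1 → ℝ => 1 / Real.sqrt (aeval (x 0) (G.comp (X ^ 2)))) {x | x 0 ∈ Ioo α β} →
      ∃ E t : KZ.IntegralRep 1, E.domain = {x | x 0 ∈ Ioo α β} ∧
        E.integrand = (fun x => (a₀ : ℝ) / Real.sqrt (aeval (x 0) (G.comp (X ^ 2)))) ∧
        t.domain = {x | x 0 ∈ (fun y : ℝ => ((y ^ 2)⁻¹ - s) / m) '' Ioo α β} ∧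
        EqOn t.integrand (fun x => ((a₀ * |m| / (2 * |k|) : ℚ) : ℝ) /
          Real.sqrt (x 0 ^ 3 + (A : ℝ) * x 0 + (B : ℝ))) t.domain ∧
        KZ.of E - KZ.of t ∈ KZ.relations)

/-- The antecedent of the one open stub is LANDED (p144820). -/
theorem halfMovesSa_holds : HalfMovesSa := BiellipticRealPeriodCellStubs.HalfMoves.stub_halfMoves

/-- Hence the crux closes from the Sa-assembly alone: the remaining work of the live line is
exactly `HalfMovesSa → GeneratorwiseTransfer` (= `stub_assembly_of_halfMovesSa`, i.e. the landed
assembly p144190 with `IsSemialgebraic` threaded through its six `hF` call sites — the landed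
proof already computes the three facts `_hsap`, `_hsan`, `_hsaK` it needs). -/
theorem crux_of_saAssembly (hSa : HalfMovesSa → GeneratorwiseTransfer) : BiellipticRealPeriodCell :=
  crux_of_subs cellOneKernel_holds (hSa halfMovesSa_holds)

-- For the record: the NON-Sa assembly is landed too (p144190) — `stub_assembly_of_halfMoves` —
-- but its hypothesis (half-moves for ALL real `α < β`) is unprovable as typed (an `IntegralRep`
-- domain must be `ℚ`-semialgebraic; `β = π` fails), which is why the lead re-registered the Sa pair.
#check @BiellipticRealPeriodCellStubs.Assembly.stub_assembly_of_halfMoves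

/-- Generators of S⁺⁺ (IsBounded dropped). -/
def withoutBoundedGens : Set KZ.FormalRep :=
  {d : KZ.FormalRep | ∃ (G : Polynomial ℚ) (q a₀ a₁ : ℚ) (r : KZ.IntegralRep 1), G.natDegree = 3 ∧
    Squarefree (G.comp (Polynomial.X ^ 2)) ∧
    0 < Polynomial.aeval (q : ℝ) (G.comp (Polynomial.X ^ 2)) ∧
    r.domain = {x | x 0 ∈ connectedComponentIn {y : ℝ | 0 < Polynomial.aeval y (G.comp (Polynomial.X ^ 2))} (q : ℝ)} ∧
    Set.EqOn r.integrand (fun x => ((a₀ : ℝ) + (a₁ : ℝ) * x 0) /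
      Real.sqrt (Polynomial.aeval (x 0) (G.comp (Polynomial.X ^ 2)))) r.domain ∧
    d = KZ.of r}

/-- S⁺⁺ in kernel form. -/
def WithoutBounded : Prop :=
  ∀ c ∈ AddSubgroup.closure withoutBoundedGens, KZ.eval c = 0 → c ∈ KZ.relations

theorem biellGens_subset_withoutBoundedGens : biellGens ⊆ withoutBoundedGens := by
  rintro d ⟨G, q, a₀, a₁, r, h1, h2, h3, -, h5, h6, h7⟩
  exact ⟨G, q, a₀, a₁, r, h1, h2, h3, h5, h6, h7⟩

/-- **Strengthen heading, S⁺⁺ = IsBounded dropped**: sandwiched between Conjecture 1 (kernel form)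
and the crux, hence true iff KZ and no more rigid than the crux for THIS step; Disproof F3 shows its
extra generators exit the booked cells (incomplete `E₂`-integral). -/
theorem withoutBounded_sandwich :
    (KZKernelConjecture → WithoutBounded) ∧ (WithoutBounded → BiellipticRealPeriodCell) :=
  ⟨fun h c _ h0 => h c h0,
   fun h c hc h0 => h c (AddSubgroup.closure_mono biellGens_subset_withoutBoundedGens hc) h0⟩

/-- Generators of the genus-two cell (verbatim from `GenusTwoRealPeriodCell`, rev 21 order). -/
def genusTwoGens : Set KZ.FormalRep :=
  {d : KZ.FormalRep | ∃ (F : Polynomial ℚ) (q a₀ a₁ : ℚ) (r : KZ.IntegralRep 1), Squarefree F ∧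
      (F.natDegree = 5 ∨ F.natDegree = 6) ∧ 0 < Polynomial.aeval (q : ℝ) F ∧
      r.domain = {x | x 0 ∈ connectedComponentIn {y : ℝ | 0 < Polynomial.aeval y F} (q : ℝ)} ∧
      Set.EqOn r.integrand (fun x => ((a₀ : ℝ) + (a₁ : ℝ) * x 0) / Real.sqrt (Polynomial.aeval (x 0) F)) r.domain ∧
      d = KZ.of r}

theorem biellGens_subset_genusTwoGens : biellGens ⊆ genusTwoGens := by
  rintro d ⟨G, q, a₀, a₁, r, hdeg, hsq, hpos, -, hdom, hint, rfl⟩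
  refine ⟨G.comp (Polynomial.X ^ 2), q, a₀, a₁, r, hsq, Or.inr ?_, hpos, hdom, hint, rfl⟩
  rw [Polynomial.natDegree_comp, Polynomial.natDegree_X_pow, hdeg]

/-- **Strengthen heading, S⁺ = the genus-two cell** gives the crux by closure monotonicity; it is
HARDER (HW 13.3 (2) for abelian surfaces unvendored), so no leverage here. -/
theorem crux_of_genusTwo (h : GenusTwoRealPeriodCell) : BiellipticRealPeriodCell :=
  fun c hc h0 => h c (AddSubgroup.closure_mono biellGens_subset_genusTwoGens hc) h0

#print axioms crux_of_saAssembly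

end Summit.KontsevichZagierPeriods.KontsevichZagierPeriods.Cruxes.BiellipticRealPeriodCell.StrategyCensus

end
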